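/-
Origin: expansion seat `planner-pub-hodgecm-mc-axioms-1-g14-0`, handover #W13 2026-08-20T15:53:55Z md5 1187f7c12ace (PKG 5b28220f2acc → 1187f7c12ace; 77 l.; MECHANICAL (iib-R) rewrite v3.1 of the PKG file as it stands (9 token edits; rules R1x1+RX[h₂]x8)) (`HOME/mc/pub-hodgecm-mc-axioms-1-g14/revendor/kit-r55/stage55/HodgeCM/Model/GoodSexticWitnessO.lean`, md5 1187f7c12ace, 77 lines);
landed by the gen-22 packager (p-g22) in gate run 55 REPLACES the earlier landed copy of `HodgeCM/Model/GoodSexticWitnessO.lean` (seat copy carried the packager Origin header of an earlier run (stripped)).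
-/
/-
Origin: speedrun cell pub-hodgecm, MODEL-CONSTRUCTION sub-cell, lineage mc-theta-3 (theta supply / second-lift lane),
seat planner-pub-hodgecm-mc-theta-3-g12-0 (gen 12), 2026-08-20.  Target in PKG: `HodgeCM/Model/GoodSexticWitnessO.lean`
(NEW additive leaf over `HodgeCM.Model.GoodSexticWitness` ONLY; nothing imports it yet).  KERNEL only: 0 records / named
facts / proof holes.  Ruling (ORIENT-h) (o), E-side design of record = glue-1's ORIENTED FAMILY (STATUS l.12529 / l.12532
(S1)): the non-vacuity witness of the oriented binders, stated over `thetaModelOf … (hb L ι₁) …` directly.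
-/
import Summits.HodgeConjecture.HodgeCM.Model.GoodSexticWitness

/-!
# The ORIENTED family of END-STATE models admits an anisotropic good sextic context

For an oriented recipe bit `hb : ∀ L : CMField, (L →+* ℂ) → Bool` the E term of the oriented design consumes, at the
universe point `(L, ι₁)`, the installed model `thetaModelOf … (hb L ι₁) …` (no new model symbol).  Its `GoodCtx`-guarded
binders are NOT vacuous: `exists_anisotropic_goodSexticO` produces `(L, ι₁, V, c)` with `IsAnisotropic L V.Hm`,
`(thetaModelOf … (hb L ι₁) …).GoodCtx ι₁ c` and `finrank ℚ c.K = 6` — the proof of `exists_anisotropic_goodSextic` verbatim: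
PerL's own hypothesis class fixes `(K, L, j, ι₁, t)` FIRST (`perLHypothesesInhabited`), and the seesaw datum is then
constructed from the sign recipe AT THE BIT `hb L ι₁` of that universe point (`design_kappaConj_of_eq (hb L ι₁) rfl`).
`not_noGoodSextic₀O` is the matching negation of the SANITY lane's vacuity residual in the oriented binder shape.
-/

noncomputable section

namespace HodgeCM
namespace Model

open HodgeCM.Universe (SideData ThetaModel)
open Literature.AlgebraicGeometry.HodgeTheory
open Literature.NumberTheory.Automorphic.PicardCM

variable (hHD : exists_isReal_hodgeModel) (hI : hodgePQ_independent_of_hodgeModel)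
  (h₁ : BallQuotientUniformised)  (h₃ : CMAbelianVarietyRealised)

/-- **The ORIENTED family of END-STATE theta models admits an anisotropic good sextic context**, for ANY oriented bit
`hb` and ANY data `(emb, cover, wm, Theta, d12, d34)`. -/
theorem exists_anisotropic_goodSexticO (hb : ∀ L : CMField, (L →+* ℂ) → Bool) (emb) (cover) (wm) (Theta)
    (d12 d34 : ∀ {L : CMField}, SeesawCtx L → SideData L) :
    ∃ (L : CMField) (ι₁ : L →+* ℂ) (V : HermSpace3 L ι₁) (c : SeesawCtx L),
      IsAnisotropic L V.Hm ∧ (thetaModelOf hHD hI h₁ h₃ (hb L ι₁) emb cover wm Theta d12 d34).GoodCtx ι₁ c ∧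
        Module.finrank ℚ c.K = 6 := by
  obtain ⟨K, L, j, _hN, hK, hL, φ, hφ, ι₁, hι₁, t, ht⟩ := HodgeCM.perLHypothesesInhabited
  have hκ := (thetaModelOf hHD hI h₁ h₃ (hb L ι₁) emb cover wm Theta d12 d34).design_kappaConj_of_eq (hb L ι₁) rfl
  have hs := (thetaModelOf hHD hI h₁ h₃ (hb L ι₁) emb cover wm Theta d12 d34).design_frameSignConj_of_eq rfl
  have hΨ : PairSum t := StubTree.pairSum_of_isPerLTypes K φ hφ hK t ht
  obtain ⟨D, hD⟩ :=
    (thetaModelOf hHD hI h₁ h₃ (hb L ι₁) emb cover wm Theta d12 d34).exists_seesawDatum_constructed hκ hs j ι₁ t hΨ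
  obtain ⟨V⟩ := StubTree.landherr_exists L ι₁
  have h4 : 4 ≤ Module.finrank ℚ L := by rcases hL with hL | hL <;> omega
  exact ⟨L, ι₁, V, ⟨K, t, φ 0, D⟩, V.isAnisotropic h4,
    ⟨hΨ, StubTree.injective_of_isPerLTypes K φ hφ t ht, fun i => (ht i 0).mpr (by fin_cases i <;> rfl),
      ⟨j, hι₁, hD⟩⟩, hK⟩

/-- **No "no good sextic context" for the ORIENTED family** (negation of the SANITY lane's vacuity residual in the
oriented binder shape `… (thetaModelOf … (hb L ι₁) …).GoodCtx ι₁ c → finrank ℚ c.K ≠ 6`). -/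
theorem not_noGoodSextic₀O (hb : ∀ L : CMField, (L →+* ℂ) → Bool) (emb) (cover) (wm) (Theta)
    (d12 d34 : ∀ {L : CMField}, SeesawCtx L → SideData L) :
    ¬ (∀ {L : CMField} {ι₁ : L →+* ℂ} (V : HermSpace3 L ι₁) (c : SeesawCtx L), IsAnisotropic L V.Hm →
        (thetaModelOf hHD hI h₁ h₃ (hb L ι₁) emb cover wm Theta d12 d34).GoodCtx ι₁ c → Module.finrank ℚ c.K ≠ 6) := by
  intro hno
  obtain ⟨L, ι₁, V, c, hV, hc, h6⟩ := exists_anisotropic_goodSexticO hHD hI h₁ h₃ hb emb cover wm Theta d12 d34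
  exact hno V c hV hc h6

/-- at a CONSTANT oriented bit the witness is `exists_anisotropic_goodSextic`'s statement (sanity; by `exact`). -/
example (h : Bool) (emb) (cover) (wm) (Theta) (d12 d34 : ∀ {L : CMField}, SeesawCtx L → SideData L) :
    ∃ (L : CMField) (ι₁ : L →+* ℂ) (V : HermSpace3 L ι₁) (c : SeesawCtx L),
      IsAnisotropic L V.Hm ∧ (thetaModelOf hHD hI h₁ h₃ h emb cover wm Theta d12 d34).GoodCtx ι₁ c ∧
        Module.finrank ℚ c.K = 6 :=
  exists_anisotropic_goodSexticO hHD hI h₁ h₃ (fun _ _ => h) emb cover wm Theta d12 d34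

end Model
end HodgeCM

end
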